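import Summits.MatrixMultiplication.MatrixMultiplication.Theorems.FarEdgeDescentSquareGerm
import Mathlib.MeasureTheory.Integral.IntervalIntegral.FundThmCalculus
import HarnessLib

/-!
# Route `FarEdgeDescent` — THE CURVATURE LAW of the square–cube pencil, II: area laws, the barycentre law, and the
second-moment rung (lens-2 «special vs generic», gen 26; support module, def-free)

Companion of `FarEdgeDescentCurvatureLaw` (same generation; this module does not import it).  With
`f(x) := ω(1,x,1)` (tree `omegaRect ℂ 1 x 1`), `e(x) := f(x) − (x+1)` and the slope function `σ := ∂⁺f`
(`derivWithin f (Ioi ·) ·`, everywhere defined and non-decreasing because `f` is convex on `ℝ`,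
`FarEdgeDescentNearVertex.profile_convexOn_univ`; the distribution function of the CURVATURE LAW `μ = f″`):

* §1 ★ AREA LAWS.  The continuous convex profile is the integral of its slope function, `f(b) − f(a) = ∫_a^b σ`
  (`integral_rightDeriv`, FTC with right derivatives).  Hence `ω − 2 = ∫₀¹ σ = ∫_α^1 σ` — the summit excess IS
  the slope mass accumulated left of the square — and `e(X) = (ω − 2) − ∫₁^X (1 − σ)`: the far-edge excess is
  the part of that mass not yet repaid by slope deficit.  The landed `LogRate` in real form (`tendsto_excess_atTop`,
  `e(x) → 0`) then gives EQUAL AREAS `∫₁^X (1 − σ) ↑ ω − 2` (`tendsto_integral_far_deficit`) and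
  `∫₀^X (1 − σ) → 1` (`tendsto_integral_one_sub_rightDeriv`): THE BARYCENTRE OF THE CURVATURE LAW IS THE SQUARE,
  `∫ s dμ(s) = 1`.  (So `e(x) = ∫ (s−x)⁺ dμ`, `f(x) − 2 = ∫ (x−s)⁺ dμ` — put–call parity `(f−2) − e = x − 1` —,
  `ω − 2 = ½ ∫ |s − 1| dμ` is the mean absolute deviation of the law from the square, the fold
  `FarEdgeDescentAlphaPrice.dualDefect_le_excess` is a put–call inequality between the conjugate strikes
  `2/(1+x)` and `x`, and `ω = 2` iff the law is the point mass at its own barycentre.)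
* §2 A NEW RUNG, the SECOND MOMENT: integrable excess `∫₁^∞ e < ∞` (`= ½ ∫ ((s−1)⁺)² dμ`, finite variance of
  the law).  `ω = 2 ⟹` it, `FiniteSaturation ⟹` it, `PowerAmortisation` with `δ > 1 ⟹` it, and it
  `⟹ PowerAmortisation` with `δ = 1` (`powerAmortisation_of_integrableOn_excess`, Chebyshev step
  `(X−1)·e(X) ≤ ∫₁^∞ e`): a new edge INTO the converting child stmt-MatrixMultiplication-25347 of the special crux
  stmt-MatrixMultiplication-23739 (`integrableExcess_sandwich`).  It is not implied by the landed `LogRate`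
  (`1/log` is not integrable) and is refuted in-class exactly like `PowerAmortisation` (CLLZ barrier excess
  `Θ(1/(k log²k))` for Coppersmith–Winograd-type profiles).

All statements are over `omegaRect ℂ`, `omega ℂ`, `dualExponentAlpha ℂ`, `_root_.MatrixMultiplication` and the
route decls; no `def`s; imports only landed modules.  Nothing here proves `ω = 2`.
[cite: LottiRomani1983, §2 (p. 174)] [cite: HuangPan1998, §2 eq. (2.5)–(2.8)] [cite: Rockafellar1970, Thm. 24.2,
Cor. 24.2.1] [cite: CoppersmithWinograd1990, §6] [cite: ChristandlLeGallLysikovZuiddam2025, Rem. 3.13]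
-/

set_option linter.dupNamespace false

noncomputable section

namespace Summit.MatrixMultiplication.MatrixMultiplication.Theorems.FarEdgeDescentBarycentreLaw

open Literature.Computability.AlgebraicComplexity
open Summit.MatrixMultiplication.MatrixMultiplication.Theses.FarEdgeDescent
  (FiniteSaturation PowerAmortisation)
open Summit.MatrixMultiplication.MatrixMultiplication.Theorems.FarEdgeDescentNearVertex
  (profile_convexOn_univ mem_interior_univ hasRightDerivAt)
open Summit.MatrixMultiplication.MatrixMultiplication.Theorems.FarEdgeDescentChord
  (excess_antitone saturated_of_omega_eq_two)
open Summit.MatrixMultiplication.MatrixMultiplication.Theorems.FarEdgeDescentTameProfile (exists_nat_excess_lt)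
open Filter Topology Set MeasureTheory intervalIntegral

/-! ## §1 ★ Area laws: the profile is the integral of its slope; the barycentre of the law is the square -/

/-- `σ` is integrable on every bounded interval (it is monotone). -/
theorem intervalIntegrable_rightDeriv (a b : ℝ) :
    IntervalIntegrable (fun t : ℝ => derivWithin (fun y : ℝ => omegaRect ℂ 1 y 1) (Ioi t) t) volume a b := by
  have hmono : Monotone (fun x : ℝ => derivWithin (fun y : ℝ => omegaRect ℂ 1 y 1) (Ioi x) x) :=
    fun x y hxy => profile_convexOn_univ.monotoneOn_rightDeriv (mem_interior_univ x) (mem_interior_univ y) hxy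
  exact hmono.intervalIntegrable

/-- ★ **The profile is the integral of its slope function**: `f(b) − f(a) = ∫_a^b σ` for `a ≤ b` (FTC for the
continuous convex profile and its everywhere-existing right derivative). -/
theorem integral_rightDeriv {a b : ℝ} (hab : a ≤ b) :
    ∫ t in a..b, derivWithin (fun y : ℝ => omegaRect ℂ 1 y 1) (Ioi t) t =
      omegaRect ℂ 1 b 1 - omegaRect ℂ 1 a 1 :=
  integral_eq_sub_of_hasDeriv_right_of_le hab (continuous_omegaRect_one_mid_one ℂ).continuousOn
    (fun x _ => hasRightDerivAt x) (intervalIntegrable_rightDeriv a b)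

/-- ★ **`ω − 2 = ∫₀¹ σ`**: the summit excess is exactly the slope mass accumulated LEFT of the square. -/
theorem omega_sub_two_eq_integral :
    omega ℂ - 2 = ∫ t in (0 : ℝ)..1, derivWithin (fun y : ℝ => omegaRect ℂ 1 y 1) (Ioi t) t := by
  rw [integral_rightDeriv zero_le_one, omegaRect_one_one_one, omegaRect_one_zero_one]

/-- … all of which lives on `[α, 1]`: `ω − 2 = ∫_α^1 σ`. -/
theorem omega_sub_two_eq_integral_alpha :
    omega ℂ - 2 =
      ∫ t in (dualExponentAlpha ℂ)..1, derivWithin (fun y : ℝ => omegaRect ℂ 1 y 1) (Ioi t) t := by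
  rw [integral_rightDeriv (dualExponentAlpha_le_one ℂ), omegaRect_one_one_one, omegaRect_dualExponentAlpha]

/-- ★ **The far-edge excess as the unspent slope deficit**: `e(X) = (ω − 2) − ∫₁^X (1 − σ)` for `X ≥ 1`. -/
theorem excess_eq_sub_integral {X : ℝ} (hX : 1 ≤ X) :
    omegaRect ℂ 1 X 1 - (X + 1) =
      (omega ℂ - 2) - ∫ t in (1 : ℝ)..X, (1 - derivWithin (fun y : ℝ => omegaRect ℂ 1 y 1) (Ioi t) t) := by
  rw [intervalIntegral.integral_sub intervalIntegrable_const (intervalIntegrable_rightDeriv 1 X),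
    intervalIntegral.integral_const, integral_rightDeriv hX, omegaRect_one_one_one, smul_eq_mul, mul_one]
  ring

/-- The slope deficit right of the square never exceeds the summit excess: `∫₁^X (1 − σ) ≤ ω − 2` (`e ≥ 0`). -/
theorem integral_far_deficit_le {X : ℝ} (hX : 1 ≤ X) :
    ∫ t in (1 : ℝ)..X, (1 - derivWithin (fun y : ℝ => omegaRect ℂ 1 y 1) (Ioi t) t) ≤ omega ℂ - 2 := by
  have h := excess_eq_sub_integral hX
  have hlb := add_one_le_omegaRect_one_mid_one ℂ X
  linarith

/-- `∫₀^X (1 − σ) = 1 − e(X)` for `X ≥ 0`. -/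
theorem integral_one_sub_rightDeriv_eq {X : ℝ} (hX : 0 ≤ X) :
    ∫ t in (0 : ℝ)..X, (1 - derivWithin (fun y : ℝ => omegaRect ℂ 1 y 1) (Ioi t) t) =
      1 - (omegaRect ℂ 1 X 1 - (X + 1)) := by
  rw [intervalIntegral.integral_sub intervalIntegrable_const (intervalIntegrable_rightDeriv 0 X),
    intervalIntegral.integral_const, integral_rightDeriv hX, omegaRect_one_zero_one, smul_eq_mul, mul_one]
  ring

/-- The landed `LogRate` in real form: `e(x) → 0` as the real shape `x → ∞` (`e` is non-increasing and
nonnegative, and small at large integers by `FarEdgeDescentTameProfile.exists_nat_excess_lt`). -/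
theorem tendsto_excess_atTop :
    Tendsto (fun x : ℝ => omegaRect ℂ 1 x 1 - (x + 1)) atTop (𝓝 0) := by
  rw [Metric.tendsto_atTop]
  intro ε hε
  obtain ⟨k, -, -, hk⟩ := exists_nat_excess_lt hε 0
  refine ⟨k, fun x hx => ?_⟩
  have h1 := excess_antitone hx
  have h0 : 0 ≤ omegaRect ℂ 1 x 1 - (x + 1) := by linarith [add_one_le_omegaRect_one_mid_one ℂ x]
  rw [Real.dist_eq, sub_zero, abs_of_nonneg h0]
  linarith

/-- ★ **EQUAL AREAS.**  The slope deficit right of the square fills up exactly the summit excess: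
`∫₁^X (1 − σ) → ω − 2 = ∫₀¹ σ` — slope mass left of the square equals slope deficit right of it. -/
theorem tendsto_integral_far_deficit :
    Tendsto (fun X : ℝ => ∫ t in (1 : ℝ)..X, (1 - derivWithin (fun y : ℝ => omegaRect ℂ 1 y 1) (Ioi t) t))
      atTop (𝓝 (omega ℂ - 2)) := by
  have h : Tendsto (fun X : ℝ => (omega ℂ - 2) - (omegaRect ℂ 1 X 1 - (X + 1))) atTop (𝓝 (omega ℂ - 2)) := by
    simpa using (tendsto_const_nhds (x := omega ℂ - 2) (f := (atTop : Filter ℝ))).sub tendsto_excess_atTop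
  refine h.congr' ?_
  filter_upwards [eventually_ge_atTop 1] with X hX
  have h2 := excess_eq_sub_integral hX
  linarith

/-- ★ **THE BARYCENTRE OF THE CURVATURE LAW IS THE SQUARE**: `∫₀^X (1 − σ) → 1`, i.e. `∫₀^∞ (1 − σ(t)) dt = 1`
— for the law `μ` with distribution function `σ` on `[0, ∞)` this is `∫ s dμ(s) = 1`. -/
theorem tendsto_integral_one_sub_rightDeriv :
    Tendsto (fun X : ℝ => ∫ t in (0 : ℝ)..X, (1 - derivWithin (fun y : ℝ => omegaRect ℂ 1 y 1) (Ioi t) t))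
      atTop (𝓝 1) := by
  have h : Tendsto (fun X : ℝ => 1 - (omegaRect ℂ 1 X 1 - (X + 1))) atTop (𝓝 1) := by
    simpa using (tendsto_const_nhds (x := (1 : ℝ)) (f := (atTop : Filter ℝ))).sub tendsto_excess_atTop
  refine h.congr' ?_
  filter_upwards [eventually_ge_atTop 0] with X hX
  exact (integral_one_sub_rightDeriv_eq hX).symm

/-! ## §2 A new rung: integrable excess (finite second moment of the curvature law) -/

/-- `ω = 2 ⟹` the excess is integrable on `(1, ∞)` (it vanishes there). -/
theorem integrableOn_excess_of_mm (hS : _root_.MatrixMultiplication) :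
    IntegrableOn (fun x : ℝ => omegaRect ℂ 1 x 1 - (x + 1)) (Ioi 1) := by
  have hω : omega ℂ = 2 := by rwa [_root_.MatrixMultiplication_iff] at hS
  refine integrableOn_zero.congr_fun (fun x hx => ?_) measurableSet_Ioi
  show (0 : ℝ) = omegaRect ℂ 1 x 1 - (x + 1)
  rw [saturated_of_omega_eq_two hω (le_of_lt hx)]
  ring

/-- `FiniteSaturation ⟹` the excess is integrable on `(1, ∞)` (continuous on `[1, k]`, zero on `[k, ∞)`). -/
theorem integrableOn_excess_of_finiteSaturation (hF : FiniteSaturation) :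
    IntegrableOn (fun x : ℝ => omegaRect ℂ 1 x 1 - (x + 1)) (Ioi 1) := by
  obtain ⟨k, hk, hs⟩ := hF
  have hcont : Continuous (fun x : ℝ => omegaRect ℂ 1 x 1 - (x + 1)) :=
    (continuous_omegaRect_one_mid_one ℂ).sub (continuous_id.add continuous_const)
  have h1 : IntegrableOn (fun x : ℝ => omegaRect ℂ 1 x 1 - (x + 1)) (Icc 1 (k : ℝ)) :=
    hcont.integrableOn_Icc
  have h2 : IntegrableOn (fun x : ℝ => omegaRect ℂ 1 x 1 - (x + 1)) (Ici (k : ℝ)) := by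
    refine integrableOn_zero.congr_fun (fun x hx => ?_) measurableSet_Ici
    have hkx : (k : ℝ) ≤ x := hx
    have hup := excess_antitone hkx
    have hlo := add_one_le_omegaRect_one_mid_one ℂ x
    have hek : omegaRect ℂ 1 (k : ℝ) 1 - ((k : ℝ) + 1) = 0 := by rw [hs]; ring
    show (0 : ℝ) = omegaRect ℂ 1 x 1 - (x + 1)
    linarith
  refine (h1.union h2).mono_set ?_
  intro x hx
  rcases le_or_gt (k : ℝ) x with hkx | hxk
  · exact Or.inr hkx
  · exact Or.inl ⟨le_of_lt hx, hxk.le⟩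

/-- CHEBYSHEV STEP: under integrable excess, `(X − 1)·e(X) ≤ ∫_{(1,∞)} e` for every real `X > 1`
(`e` is non-increasing, so `e ≥ e(X)` on `(1, X]`). -/
theorem excess_mul_le_integral (hI : IntegrableOn (fun x : ℝ => omegaRect ℂ 1 x 1 - (x + 1)) (Ioi 1))
    {X : ℝ} (hX : 1 < X) :
    (X - 1) * (omegaRect ℂ 1 X 1 - (X + 1)) ≤ ∫ x in Ioi 1, (omegaRect ℂ 1 x 1 - (x + 1)) := by
  have hsub : Ioc 1 X ⊆ Ioi 1 := fun x hx => hx.1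
  have hIoc : IntegrableOn (fun x : ℝ => omegaRect ℂ 1 x 1 - (x + 1)) (Ioc 1 X) := hI.mono_set hsub
  have hnonneg : ∀ x : ℝ, 0 ≤ omegaRect ℂ 1 x 1 - (x + 1) := fun x => by
    linarith [add_one_le_omegaRect_one_mid_one ℂ x]
  have hvol : volume.real (Ioc 1 X) = X - 1 := by
    rw [Real.volume_real_Ioc, max_eq_left (by linarith)]
  calc (X - 1) * (omegaRect ℂ 1 X 1 - (X + 1))
      = ∫ x in Ioc 1 X, (omegaRect ℂ 1 X 1 - (X + 1)) := by
        rw [setIntegral_const, hvol, smul_eq_mul]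
    _ ≤ ∫ x in Ioc 1 X, (omegaRect ℂ 1 x 1 - (x + 1)) :=
        setIntegral_mono_on (integrableOn_const (by rw [Real.volume_Ioc]; exact ENNReal.ofReal_ne_top))
          hIoc measurableSet_Ioc (fun x hx => excess_antitone hx.2)
    _ ≤ ∫ x in Ioi 1, (omegaRect ℂ 1 x 1 - (x + 1)) :=
        setIntegral_mono_set hI (Eventually.of_forall fun x => hnonneg x) hsub.eventuallyLE

/-- ★ **INTEGRABLE EXCESS ⟹ `PowerAmortisation`** (child stmt-MatrixMultiplication-25347 of the special crux),
with exponent `δ = 1` and constant `max (ω − 2) (2 ∫_{(1,∞)} e)`: for `k ≥ 2`, `e(k) ≤ ∫e/(k − 1) ≤ 2∫e/k`. -/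
theorem powerAmortisation_of_integrableOn_excess
    (hI : IntegrableOn (fun x : ℝ => omegaRect ℂ 1 x 1 - (x + 1)) (Ioi 1)) : PowerAmortisation := by
  refine ⟨1, max (omega ℂ - 2) (2 * ∫ x in Ioi 1, (omegaRect ℂ 1 x 1 - (x + 1))), one_pos, fun k hk => ?_⟩
  rw [Real.rpow_neg_one]
  have hkpos : (0 : ℝ) < k := by exact_mod_cast hk
  rw [← div_eq_mul_inv, le_div_iff₀ hkpos]
  rcases eq_or_lt_of_le hk with hk1 | hk2
  · subst hk1
    rw [Nat.cast_one, omegaRect_one_one_one]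
    have : omega ℂ - (1 + 1) = omega ℂ - 2 := by ring
    rw [this, mul_one]
    exact le_max_left _ _
  · have hk2' : (2 : ℝ) ≤ k := by exact_mod_cast hk2
    have h := excess_mul_le_integral hI (X := k) (by linarith)
    have hek : 0 ≤ omegaRect ℂ 1 (k : ℝ) 1 - ((k : ℝ) + 1) := by
      linarith [add_one_le_omegaRect_one_mid_one ℂ (k : ℝ)]
    calc (omegaRect ℂ 1 (k : ℝ) 1 - ((k : ℝ) + 1)) * k
        ≤ 2 * ((k - 1) * (omegaRect ℂ 1 (k : ℝ) 1 - ((k : ℝ) + 1))) := by nlinarith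
      _ ≤ 2 * ∫ x in Ioi 1, (omegaRect ℂ 1 x 1 - (x + 1)) := by linarith
      _ ≤ max (omega ℂ - 2) (2 * ∫ x in Ioi 1, (omegaRect ℂ 1 x 1 - (x + 1))) := le_max_right _ _

/-- … and conversely `PowerAmortisation` with an exponent `δ > 1` gives integrable excess (`e` is non-increasing,
so `e(x) ≤ e(⌊x⌋) ≤ C⌊x⌋^{−δ} ≤ C·2^δ·x^{−δ}` on `(1, ∞)`, an integrable majorant): the new rung sits between the
exponents `δ > 1` and `δ = 1` of the converting child. -/
theorem integrableOn_excess_of_powerAmortisation_gt_one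
    (h : ∃ δ C : ℝ, 1 < δ ∧ ∀ k : ℕ, 1 ≤ k → omegaRect ℂ 1 k 1 - (k + 1) ≤ C * (k : ℝ) ^ (-δ)) :
    IntegrableOn (fun x : ℝ => omegaRect ℂ 1 x 1 - (x + 1)) (Ioi 1) := by
  obtain ⟨δ, C, hδ, hC⟩ := h
  have hcont : Continuous (fun x : ℝ => omegaRect ℂ 1 x 1 - (x + 1)) :=
    (continuous_omegaRect_one_mid_one ℂ).sub (continuous_id.add continuous_const)
  have hint : IntegrableOn (fun x : ℝ => (max C 0 * (2 : ℝ) ^ δ) * x ^ (-δ)) (Ioi 1) :=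
    (integrableOn_Ioi_rpow_of_lt (by linarith) one_pos).const_mul _
  refine Integrable.mono' hint hcont.aestronglyMeasurable ?_
  refine (ae_restrict_iff' measurableSet_Ioi).2 (Eventually.of_forall fun x hx => ?_)
  have hx1 : (1 : ℝ) < x := hx
  have hx0 : 0 ≤ x := by linarith
  set n : ℕ := ⌊x⌋₊ with hn
  have hn1 : 1 ≤ n := (Nat.le_floor_iff hx0).2 (by simpa using hx1.le)
  have hnx : (n : ℝ) ≤ x := Nat.floor_le hx0
  have hxn : x < n + 1 := Nat.lt_floor_add_one x
  have hn1' : (1 : ℝ) ≤ n := by exact_mod_cast hn1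
  have hnhalf : x / 2 ≤ n := by
    rcases le_or_gt x 2 with h2 | h2
    · linarith
    · linarith
  have hnpos : (0 : ℝ) < n := by linarith
  have he0 : 0 ≤ omegaRect ℂ 1 x 1 - (x + 1) := by linarith [add_one_le_omegaRect_one_mid_one ℂ x]
  have h1 : omegaRect ℂ 1 x 1 - (x + 1) ≤ omegaRect ℂ 1 (n : ℝ) 1 - ((n : ℝ) + 1) := excess_antitone hnx
  have h2 : omegaRect ℂ 1 (n : ℝ) 1 - ((n : ℝ) + 1) ≤ max C 0 * (n : ℝ) ^ (-δ) :=
    (hC n hn1).trans (mul_le_mul_of_nonneg_right (le_max_left _ _) (Real.rpow_nonneg hnpos.le _))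
  have h3 : (n : ℝ) ^ (-δ) ≤ (x / 2) ^ (-δ) :=
    Real.rpow_le_rpow_of_nonpos (by linarith) hnhalf (by linarith)
  have h4 : (x / 2) ^ (-δ) = (2 : ℝ) ^ δ * x ^ (-δ) := by
    rw [Real.div_rpow hx0 zero_le_two, Real.rpow_neg zero_le_two, div_inv_eq_mul, mul_comm]
  rw [Real.norm_of_nonneg he0]
  calc omegaRect ℂ 1 x 1 - (x + 1) ≤ max C 0 * (n : ℝ) ^ (-δ) := h1.trans h2
    _ ≤ max C 0 * (x / 2) ^ (-δ) := mul_le_mul_of_nonneg_left h3 (le_max_right _ _)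
    _ = max C 0 * (2 : ℝ) ^ δ * x ^ (-δ) := by rw [h4, mul_assoc]

/-- The new rung is NECESSARY for the summit and sits between the special leaf and its converting child:
`ω = 2 ⟹ FiniteSaturation ⟹ IntegrableExcess ⟹ PowerAmortisation`, and `PowerAmortisation` with `δ > 1 ⟹
IntegrableExcess`. -/
theorem integrableExcess_sandwich :
    (_root_.MatrixMultiplication → IntegrableOn (fun x : ℝ => omegaRect ℂ 1 x 1 - (x + 1)) (Ioi 1)) ∧
    (FiniteSaturation → IntegrableOn (fun x : ℝ => omegaRect ℂ 1 x 1 - (x + 1)) (Ioi 1)) ∧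
    (IntegrableOn (fun x : ℝ => omegaRect ℂ 1 x 1 - (x + 1)) (Ioi 1) → PowerAmortisation) ∧
    ((∃ δ C : ℝ, 1 < δ ∧ ∀ k : ℕ, 1 ≤ k → omegaRect ℂ 1 k 1 - (k + 1) ≤ C * (k : ℝ) ^ (-δ)) →
      IntegrableOn (fun x : ℝ => omegaRect ℂ 1 x 1 - (x + 1)) (Ioi 1)) :=
  ⟨integrableOn_excess_of_mm, integrableOn_excess_of_finiteSaturation, powerAmortisation_of_integrableOn_excess,
    integrableOn_excess_of_powerAmortisation_gt_one⟩

end Summit.MatrixMultiplication.MatrixMultiplication.Theorems.FarEdgeDescentBarycentreLaw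

end
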